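import Summits.QuantumFields.YangMills.Theorems.SmallCircleAnchorAnchorGapStubDebyeScreening10
import Summits.QuantumFields.YangMills.Theorems.SmallCircleAnchorAnchorGapStubDebyeScreening14

/-!
# Crux `AnchorGap` (stmt-QuantumFields-11141), line `registered` — DSred reduced to the `ε`-free cell ensemble

Final reduction of stub DSred (`stub_debyeScreening`, skeleton `Cruxes/AnchorGap/Lines/birth.lean`):
the regulator `ε` disappears from the remaining core.  With the zero-mode cell `S = {θ̄ ∈ D_b}` of the
commensurate dual basis `b`:

* `flatWeight_eq_weight_zero_mul` — the flat reference weight of `…StubDebyeScreening8–10` is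
  `weight₀ · e^{−(2g²)⁻¹ ε ‖φ − θ̄‖²}` exactly (`sum_sq_sub_zeroMode`);
* `flatExpect_sub_cellExpect_le` — `|⟨H⟩^flat_ε − ⟨H⟩₀| ≤ 2ε(2g²)⁻¹ ∫1_S weight₀‖φ−θ̄‖² / ∫1_S weight₀`
  for measurable `|H| ≤ 1` (`L¹` comparison of normalised averages, `1 − e^{−x} ≤ x`, and the
  well-posedness of the cell ensemble, `…StubDebyeScreening14`);
* `flatExpect_sub_cellExpect_le_box` — hence `≤ K(N, box) ε` uniformly for `g ∈ [g₁,g₂]`, `|ζ| ≤ ζm`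
  (weights compared to the `ζ = 0` weights at `g₂`, `g₁` through `|tilt| ≤ 2|ζ|VM`);
* `flatClustering_of_zero` — (X₀) ⟹ (X_flat): clustering of the `ε = 0` cell ensemble, uniform in the
  period, gives the flat-reference clustering with `ε₀(N) = δ_N/(K_N + 1)`;
* `stub_debyeScreening_of_zero` — **(X₀) ⟹ DSred** (composition with `stub_debyeScreening_of_flat`).

(X₀) — exponential clustering of admissible (measurable, bounded, local, sitewise dual-periodic)
observables under the single probability measure `∝ 1_{D_b}(θ̄(φ)) weight α g 0 ζ φ dφ` on
`((ℤ/N)³ × Fin k → ℝ)`, with constants uniform in `N`, for `ζ ≤ ζ₀(k, α, b, g₁, g₂)` — is the neutral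
vector Coulomb gas with compact zero mode: Brydges 1978 Thm 2.1 / Brydges–Federbush 1980 on the
torus with vector charges.  It is equivalent to DSred by the same comparisons; it is the honest open core.
-/

set_option autoImplicit false

noncomputable section

namespace Summit.QuantumFields.YangMills.Theorems.AnchorGap

open MeasureTheory Finset
open Literature.Probability.LatticeModels

/-- Abstract `L¹` comparison of normalised averages: for non-negative integrable weights `f₀, f₁`
with positive masses and `|H| ≤ 1`, `|∫Hf₁/∫f₁ − ∫Hf₀/∫f₀| ≤ 2 ∫|f₁ − f₀| / ∫f₀`. -/
private lemma ratio_l1_le {X : Type*} [MeasurableSpace X] (μ : Measure X) (f₀ f₁ H : X → ℝ)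
    (hf₁ : ∀ x, 0 ≤ f₁ x) (hi₀ : Integrable f₀ μ) (hi₁ : Integrable f₁ μ)
    (hH : AEStronglyMeasurable H μ) (hH1 : ∀ x, |H x| ≤ 1) (hZ₀ : 0 < ∫ x, f₀ x ∂μ) (hZ₁ : 0 < ∫ x, f₁ x ∂μ) :
    |(∫ x, H x * f₁ x ∂μ) / (∫ x, f₁ x ∂μ) - (∫ x, H x * f₀ x ∂μ) / (∫ x, f₀ x ∂μ)| ≤
      2 * (∫ x, |f₁ x - f₀ x| ∂μ) / ∫ x, f₀ x ∂μ := by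
  set Z₀ := ∫ x, f₀ x ∂μ with hZ₀def
  set Z₁ := ∫ x, f₁ x ∂μ with hZ₁def
  set L := ∫ x, |f₁ x - f₀ x| ∂μ with hLdef
  have hHn : ∀ᵐ x ∂μ, ‖H x‖ ≤ 1 := Filter.Eventually.of_forall fun x => by
    rw [Real.norm_eq_abs]; exact hH1 x
  have hiH₀ : Integrable (fun x => H x * f₀ x) μ := hi₀.bdd_mul hH hHn
  have hiH₁ : Integrable (fun x => H x * f₁ x) μ := hi₁.bdd_mul hH hHn
  have hL0 : 0 ≤ L := integral_nonneg fun x => abs_nonneg _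
  -- `|∫H(f₁ - f₀)| ≤ L`
  have hA : |(∫ x, H x * f₁ x ∂μ) - ∫ x, H x * f₀ x ∂μ| ≤ L := by
    rw [← integral_sub hiH₁ hiH₀]
    calc |∫ x, (H x * f₁ x - H x * f₀ x) ∂μ| ≤ ∫ x, |H x * f₁ x - H x * f₀ x| ∂μ := abs_integral_le_integral_abs
      _ ≤ L := integral_mono (hiH₁.sub hiH₀).abs (hi₁.sub hi₀).abs fun x => by
          simp only []
          rw [← mul_sub, abs_mul]
          exact mul_le_of_le_one_left (abs_nonneg _) (hH1 x)
  -- `|Z₁ - Z₀| ≤ L` and `|∫Hf₁| ≤ Z₁`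
  have hB : |Z₁ - Z₀| ≤ L := by
    rw [hZ₁def, hZ₀def, ← integral_sub hi₁ hi₀]
    exact abs_integral_le_integral_abs
  have hC : |∫ x, H x * f₁ x ∂μ| ≤ Z₁ := by
    calc |∫ x, H x * f₁ x ∂μ| ≤ ∫ x, |H x * f₁ x| ∂μ := abs_integral_le_integral_abs
      _ ≤ Z₁ := integral_mono hiH₁.abs hi₁ fun x => by
          simp only []
          rw [abs_mul, abs_of_nonneg (hf₁ x)]
          exact mul_le_of_le_one_left (hf₁ x) (hH1 x)
  -- decomposition
  have hdec : (∫ x, H x * f₁ x ∂μ) / Z₁ - (∫ x, H x * f₀ x ∂μ) / Z₀ =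
      ((∫ x, H x * f₁ x ∂μ) - ∫ x, H x * f₀ x ∂μ) / Z₀ + (∫ x, H x * f₁ x ∂μ) * ((Z₀ - Z₁) / (Z₀ * Z₁)) := by
    field_simp
    ring
  rw [hdec]
  calc |((∫ x, H x * f₁ x ∂μ) - ∫ x, H x * f₀ x ∂μ) / Z₀ + (∫ x, H x * f₁ x ∂μ) * ((Z₀ - Z₁) / (Z₀ * Z₁))|
      ≤ |((∫ x, H x * f₁ x ∂μ) - ∫ x, H x * f₀ x ∂μ) / Z₀| + |(∫ x, H x * f₁ x ∂μ) * ((Z₀ - Z₁) / (Z₀ * Z₁))| :=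
        abs_add_le _ _
    _ ≤ L / Z₀ + Z₁ * (L / (Z₀ * Z₁)) := by
        refine add_le_add ?_ ?_
        · rw [abs_div, abs_of_pos hZ₀]
          exact div_le_div_of_nonneg_right hA hZ₀.le
        · rw [abs_mul, abs_div, abs_of_pos (mul_pos hZ₀ hZ₁), abs_sub_comm]
          exact mul_le_mul hC (div_le_div_of_nonneg_right hB (mul_pos hZ₀ hZ₁).le) (by positivity) hZ₁.le
    _ = 2 * L / Z₀ := by
        field_simp
        ring

/-- **The flat reference weight is the `ε = 0` weight damped on the fluctuation**:
`weight_ε · e^{(2g²)⁻¹ ε V⁻¹ Σ_a(Σ_x φ)²} = weight₀ · e^{−(2g²)⁻¹ ε Σ_p (φ_p − θ̄_{p.2})²}` exactly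
(`sum_sq_sub_zeroMode`). [folklore] -/
theorem flatWeight_eq_weight_zero_mul :
    ∀ (d N k : ℕ) [NeZero N] (ι : Type) [Fintype ι] (α : ι → Fin k → ℝ) (g ε ζ : ℝ) (φ : LatticeSineGordon.Config d N k), LatticeSineGordon.weight α g ε ζ φ * Real.exp ((2 * g ^ 2)⁻¹ * (ε * ((Fintype.card (TorusSite d N) : ℝ)⁻¹ * ∑ a : Fin k, (∑ x : TorusSite d N, φ (x, a)) ^ 2))) = LatticeSineGordon.weight α g 0 ζ φ * Real.exp (-((2 * g ^ 2)⁻¹ * (ε * ∑ p : TorusSite d N × Fin k, (φ p - (Fintype.card (TorusSite d N) : ℝ)⁻¹ * ∑ y : TorusSite d N, φ (y, p.2)) ^ 2))) := by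
  intro d N k _ ι _ α g ε ζ φ
  rw [LatticeSineGordon.weight, LatticeSineGordon.weight, ← Real.exp_add, ← Real.exp_add]
  congr 1
  have hact : LatticeSineGordon.gaussianAction g ε φ = LatticeSineGordon.gaussianAction g 0 φ +
      (2 * g ^ 2)⁻¹ * (ε * ∑ p : TorusSite d N × Fin k, φ p ^ 2) := by
    unfold LatticeSineGordon.gaussianAction
    ring
  rw [hact, ← sum_sq_sub_zeroMode d N k φ]
  ring

/-- **Flat reference ensemble vs `ε = 0` cell ensemble, pointwise in the parameters.** For `g ≠ 0`,
`ε ≥ 0`, any `ζ`, and measurable `|H| ≤ 1`: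
`|⟨H⟩^flat_ε − ⟨H⟩₀| ≤ 2 ε (2g²)⁻¹ ∫ 1_S weight₀ Σ_p(φ_p − θ̄)² / ∫ 1_S weight₀` — total-variation
closeness from `0 ≤ 1 − e^{−εq} ≤ εq`. [folklore] -/
theorem flatExpect_sub_cellExpect_le :
    ∀ (d N k : ℕ) [NeZero N] (ι : Type) [Fintype ι] (α : ι → Fin k → ℝ) (b : Fin k → Fin k → ℝ), LinearIndependent ℝ b → ∀ (g ε ζ : ℝ), g ≠ 0 → 0 ≤ ε → ∀ (H : LatticeSineGordon.Config d N k → ℝ), Measurable H → (∀ φ, |H φ| ≤ 1) → let S : Set (LatticeSineGordon.Config d N k) := {φ | ∃ t : Fin k → ℝ, (∀ j : Fin k, 0 ≤ t j ∧ t j < 1) ∧ ∀ a : Fin k, (Fintype.card (TorusSite d N) : ℝ)⁻¹ * ∑ x : TorusSite d N, φ (x, a) = ∑ j : Fin k, t j * b j a}; let W : LatticeSineGordon.Config d N k → ℝ := fun φ => LatticeSineGordon.weight α g ε ζ φ * Real.exp ((2 * g ^ 2)⁻¹ * (ε * ((Fintype.card (TorusSite d N) : ℝ)⁻¹ * ∑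 a : Fin k, (∑ x : TorusSite d N, φ (x, a)) ^ 2))); let W₀ : LatticeSineGordon.Config d N k → ℝ := fun φ => LatticeSineGordon.weight α g 0 ζ φ; |(∫ φ, S.indicator (fun φ => H φ * W φ) φ) / (∫ φ, S.indicator W φ) - (∫ φ, S.indicator (fun φ => H φ * W₀ φ) φ) / (∫ φ, S.indicator W₀ φ)| ≤ 2 * (ε * ((2 * g ^ 2)⁻¹ * ∫ φ, S.indicator (fun φ => W₀ φ * ∑ p : TorusSite d N × Fin k, (φ p - (Fintype.card (TorusSite d N) : ℝ)⁻¹ * ∑ y : TorusSite d N, φ (y, p.2)) ^ 2) φ)) / ∫ φ, S.indicator W₀ φ := by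
  intro d N k _ ι _ α b hb g ε ζ hg hε H hHm hH1 S W W₀
  set q : LatticeSineGordon.Config d N k → ℝ := fun φ => (2 * g ^ 2)⁻¹ * (ε * ∑ p : TorusSite d N × Fin k,
    (φ p - (Fintype.card (TorusSite d N) : ℝ)⁻¹ * ∑ y : TorusSite d N, φ (y, p.2)) ^ 2) with hq
  have hq0 : ∀ φ, 0 ≤ q φ := fun φ => by rw [hq]; positivity
  have hWq : ∀ φ, W φ = W₀ φ * Real.exp (-(q φ)) := fun φ => flatWeight_eq_weight_zero_mul d N k ι α g ε ζ φ
  have hW₀pos : ∀ φ, 0 < W₀ φ := fun φ => LatticeSineGordon.weight_pos _ _ _ _ φ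
  have hSmeas : MeasurableSet S := measurableSet_zeroModeCell d N k b hb
  -- the two weights
  have hi₀ : Integrable (S.indicator W₀) := integrable_indicator_weight_zero d N k ι α b hb g ζ hg
  have hZ₀ : 0 < ∫ φ, S.indicator W₀ φ := integral_indicator_weight_zero_pos d N k ι α b hb g ζ hg
  have hf₀nn : ∀ φ, 0 ≤ S.indicator W₀ φ := fun φ => Set.indicator_nonneg (fun ψ _ => (hW₀pos ψ).le) φ
  have hf₁nn : ∀ φ, 0 ≤ S.indicator W φ := fun φ =>
    Set.indicator_nonneg (fun ψ _ => by rw [hWq]; exact (mul_pos (hW₀pos ψ) (Real.exp_pos _)).le) φ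
  have hle : ∀ φ, S.indicator W φ ≤ S.indicator W₀ φ := by
    intro φ
    by_cases hφ : φ ∈ S
    · rw [Set.indicator_of_mem hφ, Set.indicator_of_mem hφ, hWq]
      have : Real.exp (-(q φ)) ≤ 1 := Real.exp_le_one_iff.2 (by linarith [hq0 φ])
      nlinarith [hW₀pos φ]
    · rw [Set.indicator_of_notMem hφ, Set.indicator_of_notMem hφ]
  have hWcont : Continuous W := by
    show Continuous fun φ => LatticeSineGordon.weight α g ε ζ φ * Real.exp ((2 * g ^ 2)⁻¹ * (ε *
      ((Fintype.card (TorusSite d N) : ℝ)⁻¹ * ∑ a : Fin k, (∑ x : TorusSite d N, φ (x, a)) ^ 2)))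
    have := LatticeSineGordon.continuous_weight (d := d) (N := N) α g ε ζ
    fun_prop
  have hi₁ : Integrable (S.indicator W) :=
    hi₀.mono ((hWcont.measurable.indicator hSmeas).aestronglyMeasurable)
      (Filter.Eventually.of_forall fun φ => by
        rw [Real.norm_eq_abs, Real.norm_eq_abs, abs_of_nonneg (hf₁nn φ), abs_of_nonneg (hf₀nn φ)]
        exact hle φ)
  have hZ₁ : 0 < ∫ φ, S.indicator W φ := by
    rw [integral_pos_iff_support_of_nonneg hf₁nn hi₁, Set.support_indicator]
    have hsupp : Function.support W = Set.univ := Set.eq_univ_of_forall fun φ => by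
      rw [Function.mem_support, hWq]; exact (mul_pos (hW₀pos φ) (Real.exp_pos _)).ne'
    rw [hsupp, Set.inter_univ]
    exact volume_zeroModeCell_pos d N k b hb
  -- the abstract comparison
  have key := ratio_l1_le volume (S.indicator W₀) (S.indicator W) H hf₁nn hi₀ hi₁ hHm.aestronglyMeasurable hH1 hZ₀ hZ₁
  have hnum₁ : ∫ φ, S.indicator (fun φ => H φ * W φ) φ = ∫ φ, H φ * S.indicator W φ :=
    integral_congr_ae (Filter.Eventually.of_forall fun φ => Set.indicator_mul_right S H W)
  have hnum₀ : ∫ φ, S.indicator (fun φ => H φ * W₀ φ) φ = ∫ φ, H φ * S.indicator W₀ φ :=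
    integral_congr_ae (Filter.Eventually.of_forall fun φ => Set.indicator_mul_right S H W₀)
  rw [hnum₁, hnum₀]
  refine key.trans (div_le_div_of_nonneg_right ?_ hZ₀.le)
  refine mul_le_mul_of_nonneg_left ?_ (by norm_num)
  -- `∫ |f₁ - f₀| ≤ ε (2g²)⁻¹ ∫ 1_S W₀ Σ(φ-θ̄)²`
  have hifl := integrable_indicator_weight_zero_mul_fluct d N k ι α b hb g ζ hg
  have hpt : ∀ φ, |S.indicator W φ - S.indicator W₀ φ| ≤ S.indicator (fun φ => W₀ φ *
      ∑ p : TorusSite d N × Fin k, (φ p - (Fintype.card (TorusSite d N) : ℝ)⁻¹ * ∑ y : TorusSite d N, φ (y, p.2)) ^ 2) φ *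
        ((2 * g ^ 2)⁻¹ * ε) := by
    intro φ
    by_cases hφ : φ ∈ S
    · rw [Set.indicator_of_mem hφ, Set.indicator_of_mem hφ, Set.indicator_of_mem hφ, hWq, abs_sub_comm]
      have h1 : W₀ φ - W₀ φ * Real.exp (-(q φ)) = W₀ φ * (1 - Real.exp (-(q φ))) := by ring
      rw [h1, abs_of_nonneg (mul_nonneg (hW₀pos φ).le (by linarith [Real.exp_le_one_iff.2 (show -(q φ) ≤ 0 by linarith [hq0 φ])]))]
      have h2 : 1 - Real.exp (-(q φ)) ≤ q φ := by linarith [Real.add_one_le_exp (-(q φ))]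
      calc W₀ φ * (1 - Real.exp (-(q φ))) ≤ W₀ φ * q φ := mul_le_mul_of_nonneg_left h2 (hW₀pos φ).le
        _ = _ := by rw [hq]; ring
    · rw [Set.indicator_of_notMem hφ, Set.indicator_of_notMem hφ, Set.indicator_of_notMem hφ]
      simp
  calc ∫ φ, |S.indicator W φ - S.indicator W₀ φ| ≤ ∫ φ, S.indicator (fun φ => W₀ φ *
        ∑ p : TorusSite d N × Fin k, (φ p - (Fintype.card (TorusSite d N) : ℝ)⁻¹ * ∑ y : TorusSite d N, φ (y, p.2)) ^ 2) φ *
          ((2 * g ^ 2)⁻¹ * ε) := integral_mono (hi₁.sub hi₀).abs (hifl.mul_const _) hpt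
    _ = ε * ((2 * g ^ 2)⁻¹ * ∫ φ, S.indicator (fun φ => W₀ φ *
        ∑ p : TorusSite d N × Fin k, (φ p - (Fintype.card (TorusSite d N) : ℝ)⁻¹ * ∑ y : TorusSite d N, φ (y, p.2)) ^ 2) φ) := by
        rw [integral_mul_const]; ring


/-- **Flat reference ensemble vs `ε = 0` cell ensemble, uniformly on the parameter box.** For
`0 < g₁ ≤ g₂` and `ζm ≥ 0` there is `K = K(d, N, k, ι, α, b, g₁, g₂, ζm) ≥ 0` with
`|⟨H⟩^flat_{g,ε,ζ} − ⟨H⟩₀_{g,ζ}| ≤ K ε` for all `g ∈ [g₁, g₂]`, `|ζ| ≤ ζm`, `ε ≥ 0` and measurable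
`|H| ≤ 1` (`flatExpect_sub_cellExpect_le` with the weights compared to the `ζ = 0` weights at
`g₂`, resp. `g₁`, via `|tilt| ≤ 2|ζ|VM`). [folklore] -/
theorem flatExpect_sub_cellExpect_le_box :
    ∀ (d N k : ℕ) [NeZero N] (ι : Type) [Fintype ι] (α : ι → Fin k → ℝ) (b : Fin k → Fin k → ℝ), LinearIndependent ℝ b → ∀ (g₁ g₂ ζm : ℝ), 0 < g₁ → g₁ ≤ g₂ → 0 ≤ ζm → ∃ K : ℝ, 0 ≤ K ∧ ∀ (g ε ζ : ℝ), g₁ ≤ g → g ≤ g₂ → |ζ| ≤ ζm → 0 ≤ ε → ∀ (H : LatticeSineGordon.Config d N k → ℝ), Measurable H → (∀ φ, |H φ| ≤ 1) → let S : Set (LatticeSineGordon.Config d N k) := {φ | ∃ t : Fin k → ℝ, (∀ j : Fin k, 0 ≤ t j ∧ t j < 1) ∧ ∀ a : Fin k, (Fintype.card (TorusSite d N) : ℝ)⁻¹ * ∑ x : TorusSite d N, φ (x, a) = ∑ j : Fin k, t j * b j a}; let W : LatticeSineGordon.Config d N k → ℝ := fun φ => LatticeSineGordon.weight α g ε ζ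 φ * Real.exp ((2 * g ^ 2)⁻¹ * (ε * ((Fintype.card (TorusSite d N) : ℝ)⁻¹ * ∑ a : Fin k, (∑ x : TorusSite d N, φ (x, a)) ^ 2))); let W₀ : LatticeSineGordon.Config d N k → ℝ := fun φ => LatticeSineGordon.weight α g 0 ζ φ; |(∫ φ, S.indicator (fun φ => H φ * W φ) φ) / (∫ φ, S.indicator W φ) - (∫ φ, S.indicator (fun φ => H φ * W₀ φ) φ) / (∫ φ, S.indicator W₀ φ)| ≤ K * ε := by
  intro d N k _ ι _ α b hb g₁ g₂ ζm hg₁ hg₁₂ hζm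
  set S : Set (LatticeSineGordon.Config d N k) := {φ | ∃ t : Fin k → ℝ, (∀ j : Fin k, 0 ≤ t j ∧ t j < 1) ∧
    ∀ a : Fin k, (Fintype.card (TorusSite d N) : ℝ)⁻¹ * ∑ x : TorusSite d N, φ (x, a) = ∑ j : Fin k, t j * b j a} with hS
  have hg₂ : 0 < g₂ := lt_of_lt_of_le hg₁ hg₁₂
  set fluct : LatticeSineGordon.Config d N k → ℝ := fun φ => ∑ p : TorusSite d N × Fin k,
    (φ p - (Fintype.card (TorusSite d N) : ℝ)⁻¹ * ∑ y : TorusSite d N, φ (y, p.2)) ^ 2 with hfluct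
  have hfl0 : ∀ φ, 0 ≤ fluct φ := fun φ => sum_nonneg fun _ _ => sq_nonneg _
  -- reference integrals at `ζ = 0`
  set A : ℝ := ∫ φ, S.indicator (fun φ => LatticeSineGordon.weight α g₂ 0 0 φ * fluct φ) φ with hA
  set B : ℝ := ∫ φ, S.indicator (fun φ => LatticeSineGordon.weight α g₁ 0 0 φ) φ with hB
  have hiA := integrable_indicator_weight_zero_mul_fluct d N k ι α b hb g₂ 0 hg₂.ne'
  have hiB := integrable_indicator_weight_zero d N k ι α b hb g₁ 0 hg₁.ne'
  have hBpos : 0 < B := integral_indicator_weight_zero_pos d N k ι α b hb g₁ 0 hg₁.ne'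
  have hA0 : 0 ≤ A := integral_nonneg fun φ => Set.indicator_nonneg
    (fun ψ _ => mul_nonneg (LatticeSineGordon.weight_pos _ _ _ _ ψ).le (hfl0 ψ)) φ
  set Mι : ℝ := 2 * ζm * (Fintype.card (TorusSite d N) * Fintype.card ι) with hMι
  refine ⟨2 * ((2 * g₁ ^ 2)⁻¹ * (Real.exp Mι * A)) / (Real.exp (-Mι) * B), by positivity, ?_⟩
  intro g ε ζ hg₁g hgg₂ hζ hε H hHm hH1
  have hgpos : 0 < g := lt_of_lt_of_le hg₁ hg₁g
  have key := flatExpect_sub_cellExpect_le d N k ι α b hb g ε ζ hgpos.ne' hε H hHm hH1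
  refine key.trans ?_
  -- tilt bound and the `ζ = 0` comparisons of the weights
  have htilt : ∀ φ : LatticeSineGordon.Config d N k, |LatticeSineGordon.tilt α ζ φ| ≤ Mι := fun φ =>
    (LatticeSineGordon.abs_tilt_le (d := d) (N := N) α ζ φ).trans (by
      rw [hMι]; exact mul_le_mul_of_nonneg_right (mul_le_mul_of_nonneg_left hζ (by norm_num)) (by positivity))
  have htilt0 : ∀ (g' : ℝ) (φ : LatticeSineGordon.Config d N k), LatticeSineGordon.weight α g' 0 0 φ =
      Real.exp (-LatticeSineGordon.gaussianAction g' 0 φ) := fun g' φ => by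
    rw [LatticeSineGordon.weight]; unfold LatticeSineGordon.tilt; simp
  have hGA : ∀ (g' : ℝ) (φ : LatticeSineGordon.Config d N k), LatticeSineGordon.gaussianAction g' 0 φ =
      (2 * g' ^ 2)⁻¹ * ∑ x : TorusSite d N, ∑ i : Fin d, ∑ a : Fin k, (φ (x + Pi.single i 1, a) - φ (x, a)) ^ 2 :=
    fun g' φ => by unfold LatticeSineGordon.gaussianAction; ring
  have hGnn : ∀ φ : LatticeSineGordon.Config d N k, 0 ≤ ∑ x : TorusSite d N, ∑ i : Fin d, ∑ a : Fin k,
      (φ (x + Pi.single i 1, a) - φ (x, a)) ^ 2 := fun φ =>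
    sum_nonneg fun _ _ => sum_nonneg fun _ _ => sum_nonneg fun _ _ => sq_nonneg _
  have hup : ∀ φ : LatticeSineGordon.Config d N k, LatticeSineGordon.weight α g 0 ζ φ ≤
      Real.exp Mι * LatticeSineGordon.weight α g₂ 0 0 φ := by
    intro φ
    rw [htilt0, LatticeSineGordon.weight, ← Real.exp_add, hGA g, hGA g₂]
    refine Real.exp_le_exp.2 ?_
    have h1 := (abs_le.1 (htilt φ)).2
    have h2 : (2 * g₂ ^ 2)⁻¹ ≤ (2 * g ^ 2)⁻¹ := by
      apply inv_anti₀ (by positivity)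
      nlinarith [mul_pos hgpos hgpos, hgg₂, hgpos.le]
    nlinarith [hGnn φ, mul_le_mul_of_nonneg_right h2 (hGnn φ)]
  have hlo : ∀ φ : LatticeSineGordon.Config d N k, Real.exp (-Mι) * LatticeSineGordon.weight α g₁ 0 0 φ ≤
      LatticeSineGordon.weight α g 0 ζ φ := by
    intro φ
    rw [htilt0, LatticeSineGordon.weight, ← Real.exp_add, hGA g, hGA g₁]
    refine Real.exp_le_exp.2 ?_
    have h1 := (abs_le.1 (htilt φ)).1
    have h2 : (2 * g ^ 2)⁻¹ ≤ (2 * g₁ ^ 2)⁻¹ := by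
      apply inv_anti₀ (by positivity)
      nlinarith [mul_pos hg₁ hg₁, hg₁g, hg₁.le]
    nlinarith [hGnn φ, mul_le_mul_of_nonneg_right h2 (hGnn φ)]
  -- numerator and denominator bounds
  have hnum : ∫ φ, S.indicator (fun φ => LatticeSineGordon.weight α g 0 ζ φ * fluct φ) φ ≤ Real.exp Mι * A := by
    rw [hA, ← integral_const_mul]
    refine integral_mono (integrable_indicator_weight_zero_mul_fluct d N k ι α b hb g ζ hgpos.ne') (hiA.const_mul _)
      fun φ => ?_
    by_cases hφ : φ ∈ S
    · simp only []
      rw [Set.indicator_of_mem hφ, Set.indicator_of_mem hφ, ← mul_assoc]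
      exact mul_le_mul_of_nonneg_right (hup φ) (hfl0 φ)
    · simp only []
      rw [Set.indicator_of_notMem hφ, Set.indicator_of_notMem hφ, mul_zero]
  have hden : Real.exp (-Mι) * B ≤ ∫ φ, S.indicator (fun φ => LatticeSineGordon.weight α g 0 ζ φ) φ := by
    rw [hB, ← integral_const_mul]
    refine integral_mono (hiB.const_mul _) (integrable_indicator_weight_zero d N k ι α b hb g ζ hgpos.ne') fun φ => ?_
    by_cases hφ : φ ∈ S
    · simp only []
      rw [Set.indicator_of_mem hφ, Set.indicator_of_mem hφ]
      exact hlo φ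
    · simp only []
      rw [Set.indicator_of_notMem hφ, Set.indicator_of_notMem hφ, mul_zero]
  have hdenpos : 0 < Real.exp (-Mι) * B := by positivity
  have hg2 : (2 * g ^ 2)⁻¹ ≤ (2 * g₁ ^ 2)⁻¹ := by
    apply inv_anti₀ (by positivity)
    nlinarith [mul_pos hg₁ hg₁, hg₁g, hg₁.le]
  have hI0 : 0 ≤ ∫ φ, S.indicator (fun φ => LatticeSineGordon.weight α g 0 ζ φ * fluct φ) φ :=
    integral_nonneg fun φ => Set.indicator_nonneg
      (fun ψ _ => mul_nonneg (LatticeSineGordon.weight_pos _ _ _ _ ψ).le (hfl0 ψ)) φ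
  calc 2 * (ε * ((2 * g ^ 2)⁻¹ * ∫ φ, S.indicator (fun φ => LatticeSineGordon.weight α g 0 ζ φ * fluct φ) φ)) /
        ∫ φ, S.indicator (fun φ => LatticeSineGordon.weight α g 0 ζ φ) φ
      ≤ 2 * (ε * ((2 * g₁ ^ 2)⁻¹ * (Real.exp Mι * A))) / (Real.exp (-Mι) * B) := by
        refine div_le_div₀ (by positivity) ?_ hdenpos hden
        refine mul_le_mul_of_nonneg_left (mul_le_mul_of_nonneg_left ?_ hε) (by norm_num)
        exact mul_le_mul hg2 hnum hI0 (by positivity)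
    _ = 2 * ((2 * g₁ ^ 2)⁻¹ * (Real.exp Mι * A)) / (Real.exp (-Mι) * B) * ε := by ring


/-- Bookkeeping (as in `…StubDebyeScreening10`): three `δ`-comparisons of expectations, a clustering
bound `K` and `|⟨F⟩|, |⟨G⟩| ≤ 1` give `|⟨FG⟩ − ⟨F⟩⟨G⟩| ≤ K + 3δ + δ² ≤ 2B`. -/
private lemma glue_arith' (EFG EF EG PFG PF PG δ K B : ℝ) (h1 : |EFG - PFG| ≤ δ)
    (h2 : |EF - PF| ≤ δ) (h3 : |EG - PG| ≤ δ) (hEF : |EF| ≤ 1) (hEG : |EG| ≤ 1)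
    (hK : |PFG - PF * PG| ≤ K) (hδ0 : 0 ≤ δ) (hδ1 : δ ≤ 1) (hKB : K ≤ B) (h4 : 4 * δ ≤ B) :
    |EFG - EF * EG| ≤ 2 * B := by
  have h2' : |PF - EF| ≤ δ := by rwa [abs_sub_comm] at h2
  have h3' : |PG - EG| ≤ δ := by rwa [abs_sub_comm] at h3
  have hPG : |PG| ≤ 1 + δ := by
    have := abs_sub_abs_le_abs_sub PG EG
    linarith
  have hdec : EFG - EF * EG =
      (EFG - PFG) + (PFG - PF * PG) + ((PF - EF) * PG + EF * (PG - EG)) := by ring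
  rw [hdec]
  have t1 : |(PF - EF) * PG| ≤ δ * (1 + δ) := by
    rw [abs_mul]; exact mul_le_mul h2' hPG (abs_nonneg _) hδ0
  have t2 : |EF * (PG - EG)| ≤ 1 * δ := by
    rw [abs_mul]; exact mul_le_mul hEF h3' (abs_nonneg _) zero_le_one
  calc |(EFG - PFG) + (PFG - PF * PG) + ((PF - EF) * PG + EF * (PG - EG))|
      ≤ |EFG - PFG| + |PFG - PF * PG| + |(PF - EF) * PG + EF * (PG - EG)| := abs_add_three _ _ _
    _ ≤ δ + K + (δ * (1 + δ) + 1 * δ) :=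
        add_le_add (add_le_add h1 hK) ((abs_add_le _ _).trans (add_le_add t1 t2))
    _ ≤ 2 * B := by nlinarith

/-- **Flat-reference clustering follows from clustering of the `ε = 0` cell ensemble.** If the
truncated correlations of admissible observables cluster exponentially, uniformly in the volume, in
the neutral gas with compact zero mode `∝ 1_{D_b}(θ̄) weight α g 0 ζ dφ` (no regulator at all), then
the hypothesis (X_flat) of `stub_debyeScreening_of_flat` holds with constants `(2 max C 1, c, n₀)`
and `ε₀(N) = δ_N / (K_N + 1)`, `δ_N = min 1 ((max C 1/4) e^{−cN/2})`, `K_N` from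
`flatExpect_sub_cellExpect_le_box`. [folklore] -/
theorem flatClustering_of_zero :
    (∀ (k M : ℕ) (α : Fin M → Fin k → ℝ), (∀ v : Fin k → ℝ, (∀ r : Fin M, ∑ a : Fin k, α r a * v a = 0) → v = 0) → ∀ (b : Fin k → Fin k → ℝ), LinearIndependent ℝ b → (∀ (j : Fin k) (r : Fin M), ∃ z : ℤ, ∑ a : Fin k, α r a * b j a = 2 * Real.pi * z) → ∀ g₁ g₂ : ℝ, 0 < g₁ → g₁ ≤ g₂ → ∃ ζ₀ : ℝ, 0 < ζ₀ ∧ ∀ ζ₁ : ℝ, 0 < ζ₁ → ζ₁ ≤ ζ₀ → ∀ R₀ : ℕ, ∃ C c : ℝ, 0 < c ∧ ∃ n₀ : ℕ, ∀ (N : ℕ) [NeZero N], ∀ g ζ : ℝ, g₁ ≤ g → g ≤ g₂ → ζ₁ ≤ ζ → ζ ≤ ζ₀ → let Obs := fun F : LatticeSineGordon.Config 3 N k → ℝ => Measurable F ∧ (∀ φ, |F φ| ≤ 1) ∧ (∀ φ ψ : LatticeSineGordon.Config 3 N k, (∀ x : TorusSite 3 N, (∀ i : Fin 3, (x i).val ≤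 R₀) → ∀ a : Fin k, φ (x, a) = ψ (x, a)) → F φ = F ψ) ∧ (∀ (φ : LatticeSineGordon.Config 3 N k) (x : TorusSite 3 N) (w : Fin k → ℝ), (∀ r : Fin M, ∃ z : ℤ, ∑ a : Fin k, α r a * w a = 2 * Real.pi * z) → F (fun p => if p.1 = x then φ p + w p.2 else φ p) = F φ); let S : Set (LatticeSineGordon.Config 3 N k) := {φ | ∃ t : Fin k → ℝ, (∀ j : Fin k, 0 ≤ t j ∧ t j < 1) ∧ ∀ a : Fin k, (Fintype.card (TorusSite 3 N) : ℝ)⁻¹ * ∑ x : TorusSite 3 N, φ (x, a) = ∑ j : Fin k, t j * b j a}; let W₀ : LatticeSineGordon.Config 3 N k → ℝ := fun φ => LatticeSineGordon.weight α g 0 ζ φ; let E0 := fun H : LatticeSineGordon.Config 3 N k → ℝ => (∫ φ, S.indicator (fun φ => H φ * W₀ φ) φ) / ∫ φ, S.indicator W₀ φ; ∀ F G : LatticeSineGordon.Config 3 N k → ℝ, Obs F → Obs G → ∀ n : ℕ, n₀ < n → 2 * n < N → |E0 (fun φ => F φ * G (fun p => φ (p.1 + Pi.single 0 (n : ZMod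 N), p.2))) - E0 F * E0 (fun φ => G (fun p => φ (p.1 + Pi.single 0 (n : ZMod N), p.2)))| ≤ C * Real.exp (-(c * n))) → ∀ (k M : ℕ) (α : Fin M → Fin k → ℝ), (∀ v : Fin k → ℝ, (∀ r : Fin M, ∑ a : Fin k, α r a * v a = 0) → v = 0) → ∀ (b : Fin k → Fin k → ℝ), LinearIndependent ℝ b → (∀ (j : Fin k) (r : Fin M), ∃ z : ℤ, ∑ a : Fin k, α r a * b j a = 2 * Real.pi * z) → ∀ g₁ g₂ : ℝ, 0 < g₁ → g₁ ≤ g₂ → ∃ ζ₀ : ℝ, 0 < ζ₀ ∧ ∀ ζ₁ : ℝ, 0 < ζ₁ → ζ₁ ≤ ζ₀ → ∀ R₀ : ℕ, ∃ C c : ℝ, 0 < c ∧ ∃ n₀ : ℕ, ∀ (N : ℕ) [NeZero N], ∃ ε₀ : ℝ, 0 < ε₀ ∧ ∀ g ζ ε : ℝ, g₁ ≤ g → g ≤ g₂ → ζ₁ ≤ ζ → ζ ≤ ζ₀ → 0 < ε → ε ≤ ε₀ → let Obs := fun F : LatticeSineGordon.Config 3 N k → ℝ => Measurable F ∧ (∀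 φ, |F φ| ≤ 1) ∧ (∀ φ ψ : LatticeSineGordon.Config 3 N k, (∀ x : TorusSite 3 N, (∀ i : Fin 3, (x i).val ≤ R₀) → ∀ a : Fin k, φ (x, a) = ψ (x, a)) → F φ = F ψ) ∧ (∀ (φ : LatticeSineGordon.Config 3 N k) (x : TorusSite 3 N) (w : Fin k → ℝ), (∀ r : Fin M, ∃ z : ℤ, ∑ a : Fin k, α r a * w a = 2 * Real.pi * z) → F (fun p => if p.1 = x then φ p + w p.2 else φ p) = F φ); let S : Set (LatticeSineGordon.Config 3 N k) := {φ | ∃ t : Fin k → ℝ, (∀ j : Fin k, 0 ≤ t j ∧ t j < 1) ∧ ∀ a : Fin k, (Fintype.card (TorusSite 3 N) : ℝ)⁻¹ * ∑ x : TorusSite 3 N, φ (x, a) = ∑ j : Fin k, t j * b j a}; let W : LatticeSineGordon.Config 3 N k → ℝ := fun φ => LatticeSineGordon.weight α g ε ζ φ * Real.exp ((2 * g ^ 2)⁻¹ * (ε * ((Fintype.card (TorusSite 3 N) : ℝ)⁻¹ * ∑ a : Fin k, (∑ x : TorusSite 3 N, φ (x, a)) ^ 2))); let Ef := fun H : LatticeSineGordon.Config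 3 N k → ℝ => (∫ φ, S.indicator (fun φ => H φ * W φ) φ) / ∫ φ, S.indicator W φ; ∀ F G : LatticeSineGordon.Config 3 N k → ℝ, Obs F → Obs G → ∀ n : ℕ, n₀ < n → 2 * n < N → |Ef (fun φ => F φ * G (fun p => φ (p.1 + Pi.single 0 (n : ZMod N), p.2))) - Ef F * Ef (fun φ => G (fun p => φ (p.1 + Pi.single 0 (n : ZMod N), p.2)))| ≤ C * Real.exp (-(c * n)) := by
  intro hX k M α hspan b hb hcomm g₁ g₂ hg₁ hg₁₂
  obtain ⟨ζ₀, hζ₀, hX1⟩ := hX k M α hspan b hb hcomm g₁ g₂ hg₁ hg₁₂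
  refine ⟨ζ₀, hζ₀, fun ζ₁ hζ₁ hζ₁₀ R₀ => ?_⟩
  obtain ⟨C, c, hc, n₀, hN⟩ := hX1 ζ₁ hζ₁ hζ₁₀ R₀
  refine ⟨2 * max C 1, c, hc, n₀, fun N _ => ?_⟩
  have hmain := hN N
  -- precision at this `N`
  set Cp : ℝ := max C 1 with hCp
  have hCp1 : 1 ≤ Cp := le_max_right _ _
  have hCCp : C ≤ Cp := le_max_left _ _
  set δN : ℝ := min 1 (Cp / 4 * Real.exp (-(c * N / 2))) with hδN
  have hδNpos : 0 < δN := lt_min one_pos (by positivity)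
  have hδN1 : δN ≤ 1 := min_le_left _ _
  have hδNexp : 4 * δN ≤ Cp * Real.exp (-(c * N / 2)) := by
    have := min_le_right 1 (Cp / 4 * Real.exp (-(c * N / 2)))
    rw [← hδN] at this
    linarith
  obtain ⟨Kc, hKc0, hKc⟩ := flatExpect_sub_cellExpect_le_box 3 N k (Fin M) α b hb g₁ g₂ ζ₀ hg₁ hg₁₂ hζ₀.le
  refine ⟨δN / (Kc + 1), by positivity, ?_⟩
  intro g ζ ε hg₁g hgg₂ hζ₁ζ hζζ₀ hε hεε₀ Obs S W Ef F G hF hG n hn₀ h2n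
  have hgpos : 0 < g := lt_of_lt_of_le hg₁ hg₁g
  have hg : g ≠ 0 := hgpos.ne'
  have hζabs : |ζ| ≤ ζ₀ := abs_le.2 ⟨by linarith, hζζ₀⟩
  have hKε : Kc * ε ≤ δN := by
    calc Kc * ε ≤ Kc * (δN / (Kc + 1)) := mul_le_mul_of_nonneg_left hεε₀ hKc0
      _ ≤ δN := by
          rw [mul_div_assoc']
          rw [div_le_iff₀ (by positivity)]
          nlinarith
  -- the `ε = 0` clustering bound
  have key := hmain g ζ hg₁g hgg₂ hζ₁ζ hζζ₀ F G hF hG n hn₀ h2n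
  obtain ⟨hFm, hF1, hFloc, hFper⟩ := hF
  obtain ⟨hGm, hG1, hGloc, hGper⟩ := hG
  set Gτ : LatticeSineGordon.Config 3 N k → ℝ :=
    fun φ => G (fun p => φ (p.1 + Pi.single 0 (n : ZMod N), p.2)) with hGτ
  have hGτm : Measurable Gτ := measurable_comp_translate 3 N k (Pi.single 0 (n : ZMod N)) G hGm
  have hGτ1 : ∀ φ, |Gτ φ| ≤ 1 := fun φ => hG1 _
  have hFGm : Measurable (fun φ => F φ * Gτ φ) := hFm.mul hGτm
  have hFG1 : ∀ φ, |F φ * Gτ φ| ≤ 1 := fun φ => by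
    rw [abs_mul]
    calc |F φ| * |Gτ φ| ≤ 1 * 1 := mul_le_mul (hF1 φ) (hGτ1 φ) (abs_nonneg _) zero_le_one
      _ = 1 := one_mul 1
  -- the three comparisons flat vs cell
  have e1 := (hKc g ε ζ hg₁g hgg₂ hζabs hε.le (fun φ => F φ * Gτ φ) hFGm hFG1).trans hKε
  have e2 := (hKc g ε ζ hg₁g hgg₂ hζabs hε.le F hFm hF1).trans hKε
  have e3 := (hKc g ε ζ hg₁g hgg₂ hζabs hε.le Gτ hGτm hGτ1).trans hKε
  have hEF := abs_flatExpect_le 3 N k (Fin M) α b hb g ε ζ hg hε F hFm hF1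
  have hEG := abs_flatExpect_le 3 N k (Fin M) α b hb g ε ζ hg hε Gτ hGτm hGτ1
  -- rates
  have hexp : Real.exp (-(c * N / 2)) ≤ Real.exp (-(c * n)) := by
    refine Real.exp_le_exp.2 ?_
    have h2n' : (2 * n : ℝ) < N := by exact_mod_cast h2n
    nlinarith
  have hB4 : 4 * δN ≤ Cp * Real.exp (-(c * n)) :=
    hδNexp.trans (mul_le_mul_of_nonneg_left hexp (by linarith))
  have hKB : C * Real.exp (-(c * n)) ≤ Cp * Real.exp (-(c * n)) :=
    mul_le_mul_of_nonneg_right hCCp (Real.exp_pos _).le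
  have final := glue_arith' _ _ _ _ _ _ δN (C * Real.exp (-(c * n))) (Cp * Real.exp (-(c * n)))
    e1 e2 e3 hEF hEG key hδNpos.le hδN1 hKB hB4
  calc _ ≤ 2 * (Cp * Real.exp (-(c * n))) := final
    _ = 2 * max C 1 * Real.exp (-(c * n)) := by rw [hCp]; ring

/-- **DSred follows from clustering of the `ε = 0` cell ensemble** (composition of
`flatClustering_of_zero` with `stub_debyeScreening_of_flat`): the registered stub
`stub_debyeScreening` reduces to exponential clustering, uniform in the period, of admissible
observables under the single `ε`-free measure `∝ 1_{D_b}(θ̄(φ)) · weight α g 0 ζ φ dφ` — the neutral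
`k`-component lattice sine-Gordon / vector Coulomb gas on `(ℤ/N)³` with compact zero mode.  This is
the honest remaining core (Brydges 1978 Thm 2.1 technology on the torus with vector charges). [folklore] -/
theorem stub_debyeScreening_of_zero :
    (∀ (k M : ℕ) (α : Fin M → Fin k → ℝ), (∀ v : Fin k → ℝ, (∀ r : Fin M, ∑ a : Fin k, α r a * v a = 0) → v = 0) → ∀ (b : Fin k → Fin k → ℝ), LinearIndependent ℝ b → (∀ (j : Fin k) (r : Fin M), ∃ z : ℤ, ∑ a : Fin k, α r a * b j a = 2 * Real.pi * z) → ∀ g₁ g₂ : ℝ, 0 < g₁ → g₁ ≤ g₂ → ∃ ζ₀ : ℝ, 0 < ζ₀ ∧ ∀ ζ₁ : ℝ, 0 < ζ₁ → ζ₁ ≤ ζ₀ → ∀ R₀ : ℕ, ∃ C c : ℝ, 0 < c ∧ ∃ n₀ : ℕ, ∀ (N : ℕ) [NeZero N], ∀ g ζ : ℝ, g₁ ≤ g → g ≤ g₂ → ζ₁ ≤ ζ → ζ ≤ ζ₀ → let Obs := fun F : LatticeSineGordon.Config 3 N k → ℝ => Measurable F ∧ (∀ φ, |F φ| ≤ 1)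 ∧ (∀ φ ψ : LatticeSineGordon.Config 3 N k, (∀ x : TorusSite 3 N, (∀ i : Fin 3, (x i).val ≤ R₀) → ∀ a : Fin k, φ (x, a) = ψ (x, a)) → F φ = F ψ) ∧ (∀ (φ : LatticeSineGordon.Config 3 N k) (x : TorusSite 3 N) (w : Fin k → ℝ), (∀ r : Fin M, ∃ z : ℤ, ∑ a : Fin k, α r a * w a = 2 * Real.pi * z) → F (fun p => if p.1 = x then φ p + w p.2 else φ p) = F φ); let S : Set (LatticeSineGordon.Config 3 N k) := {φ | ∃ t : Fin k → ℝ, (∀ j : Fin k, 0 ≤ t j ∧ t j < 1) ∧ ∀ a : Fin k, (Fintype.card (TorusSite 3 N) : ℝ)⁻¹ * ∑ x : TorusSite 3 N, φ (x, a) = ∑ j : Fin k, t j * b j a}; let W₀ : LatticeSineGordon.Config 3 N k → ℝ := fun φ => LatticeSineGordon.weight α g 0 ζ φ; let E0 := fun H : LatticeSineGordon.Config 3 N k → ℝ => (∫ φ, S.indicator (fun φ => H φ * W₀ φ) φ) / ∫ φ, S.indicator W₀ φ; ∀ F G : LatticeSineGordon.Config 3 N k → ℝ, Obs F → Obs G →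 ∀ n : ℕ, n₀ < n → 2 * n < N → |E0 (fun φ => F φ * G (fun p => φ (p.1 + Pi.single 0 (n : ZMod N), p.2))) - E0 F * E0 (fun φ => G (fun p => φ (p.1 + Pi.single 0 (n : ZMod N), p.2)))| ≤ C * Real.exp (-(c * n))) → ∀ (k M : ℕ) (α : Fin M → Fin k → ℝ), (∀ v : Fin k → ℝ, (∀ r : Fin M, ∑ a : Fin k, α r a * v a = 0) → v = 0) → (∃ b : Fin k → Fin k → ℝ, LinearIndependent ℝ b ∧ ∀ (j : Fin k) (r : Fin M), ∃ z : ℤ, ∑ a : Fin k, α r a * b j a = 2 * Real.pi * z) → ∀ g₁ g₂ : ℝ, 0 < g₁ → g₁ ≤ g₂ → ∃ ζ₀ : ℝ, 0 < ζ₀ ∧ ∀ ζ₁ : ℝ, 0 < ζ₁ → ζ₁ ≤ ζ₀ → ∀ R₀ : ℕ, ∃ C c : ℝ, 0 < c ∧ ∃ n₀ : ℕ, ∀ (N : ℕ) [NeZero N], ∃ ε₀ : ℝ, 0 < ε₀ ∧ ∀ g ζ ε : ℝ, g₁ ≤ g → g ≤ g₂ → ζ₁ ≤ ζ → ζ ≤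 ζ₀ → 0 < ε → ε ≤ ε₀ → let Obs := fun F : LatticeSineGordon.Config 3 N k → ℝ => Measurable F ∧ (∀ φ, |F φ| ≤ 1) ∧ (∀ φ ψ : LatticeSineGordon.Config 3 N k, (∀ x : TorusSite 3 N, (∀ i : Fin 3, (x i).val ≤ R₀) → ∀ a : Fin k, φ (x, a) = ψ (x, a)) → F φ = F ψ) ∧ (∀ (φ : LatticeSineGordon.Config 3 N k) (x : TorusSite 3 N) (w : Fin k → ℝ), (∀ r : Fin M, ∃ z : ℤ, ∑ a : Fin k, α r a * w a = 2 * Real.pi * z) → F (fun p => if p.1 = x then φ p + w p.2 else φ p) = F φ); ∀ F G : LatticeSineGordon.Config 3 N k → ℝ, Obs F → Obs G → ∀ n : ℕ, n₀ < n → 2 * n < N → |LatticeSineGordon.truncCorr α g ε ζ F (fun φ => G (fun p => φ (p.1 + Pi.single 0 (n : ZMod N), p.2)))| ≤ C * Real.exp (-(c * n)) :=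
  fun h => stub_debyeScreening_of_flat (flatClustering_of_zero h)

end Summit.QuantumFields.YangMills.Theorems.AnchorGap

end
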